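import Mathlib
import Summits.NavierStokesRegularity.NavierStokesRegularity.Theorems.FilamentSkeletonRssStadiumQuarterFootTail
import Summits.NavierStokesRegularity.NavierStokesRegularity.Theorems.FilamentSkeletonRssStadiumQuarterFootTailLeft
import Summits.NavierStokesRegularity.NavierStokesRegularity.Theorems.FilamentSkeletonRssStadiumRealKernelIntegrable
import Summits.NavierStokesRegularity.NavierStokesRegularity.Theorems.FilamentSkeletonRssStadiumFarMajorant

/-!
# Route `FilamentSkeletonRss` · cruxes `SkeletonJ1L` (stmt-NavierStokesRegularity-23296, registered stub `stub_tangentSkeletonL` ≡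
# `TangentSkeletonNearStraightL`, stmt-23320) · line `child_tangent_analytic_strip_L` (b0b56c52900dd90a), stub `stub_stripPropagation` —
# brick for the BOUND step of `rcore`: THE TARGET'S OWN FEET ARE `O(1/hs)`

For the bound `‖U z‖ ≤ A·T(Γ)` on the target's OWN tent no freeze is needed: the foot certificates hold at the target itself for every source of
its feet (`σ − Re z ≥ hs/2`, resp. `Re z − σ ≥ hs/2`; `Theorems.StadiumQuarterFootTail.quarter_foot_re_ge`, `…Left.quarter_foot_re_ge_left`), so
ONE Lorentzian majorant covers the whole foot:
* `own_foot_kernel_le` / `own_foot_kernel_le_left` — margin `(σ − Re z)²/4`, `‖kernel‖ ≤ 32/(σ − Re z)² ≤ 160·((σ − Re z)² + (hs/2)²)⁻¹`;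
* `own_foot_right` / `own_foot_left` — for every target of the quarter stadium (`|Im z| < hs/4`, `|Re z − cc| < L + hs/4`) the real-source kernel is
  integrable on `Ioi (Re z + hs/2)` / `Iic (Re z − hs/2)` and the foot integral is bounded by `160·(π/(1·(hs/2)))` (= `320π/hs`).
HONEST FRAMING: bookkeeping for a HYPOTHETICAL filament skeleton on the NEGATIVE side of a MODEL route; the stub `stub_stripPropagation` is NOT closed
by this file, `TangentSkeletonNearStraightL` / `SkeletonJ1L` stay OPEN; nothing here bears on Navier–Stokes regularity or blow-up.
`--supports stmt-NavierStokesRegularity-23320` (≡ stub `stub_tangentSkeletonL` of 23296).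
-/

set_option linter.dupNamespace false

noncomputable section

namespace Summit.NavierStokesRegularity.NavierStokesRegularity.Theorems.StadiumQuarterOwnFeet

open Set Filter Topology Complex MeasureTheory Metric
open scoped InnerProductSpace Matrix
open Summit.NavierStokesRegularity.NavierStokesRegularity.Theorems.StadiumQuarterFootTail
open Summit.NavierStokesRegularity.NavierStokesRegularity.Theorems.StadiumQuarterFootTailLeft
open Summit.NavierStokesRegularity.NavierStokesRegularity.Theorems.StadiumRealKernelIntegrable
open Summit.NavierStokesRegularity.NavierStokesRegularity.Theorems.StadiumFarMajorant
open Summit.NavierStokesRegularity.NavierStokesRegularity.Theorems.StadiumSegmentPiece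
open Summit.NavierStokesRegularity.NavierStokesRegularity.Theorems.StadiumChordPerturb
open Summit.NavierStokesRegularity.NavierStokesRegularity.Theorems.StadiumTangentModulus
open Summit.NavierStokesRegularity.NavierStokesRegularity.Theorems.StadiumDeviationPackage
open Summit.NavierStokesRegularity.NavierStokesRegularity.Theorems.StadiumPartnerPiece

/-- **Kernel bound on the target's own right foot.**  Target of the quarter stadium, real source with `hs/2 ≤ σ − Re z`, core `κ·A σ ≥ 0`:
`(σ − Re z)²/4 ≤ Re(base)` and `‖kernel‖ ≤ 160·((σ − Re z)² + (hs/2)²)⁻¹`. [folklore] -/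
theorem own_foot_kernel_le {hs L cc κ : ℝ} {F : ℂ → (Fin 3 → ℂ)}
    (hF : DifferentiableOn ℂ F {z : ℂ | |z.im| < hs ∧ |z.re - cc| < L + hs})
    (hM : ∀ z ∈ {z : ℂ | |z.im| < hs ∧ |z.re - cc| < L + hs}, ‖deriv F z‖ ≤ 2)
    (hunit : ∀ w ∈ {z : ℂ | |z.im| < hs ∧ |z.re - cc| < L + hs}, ∑ i, (deriv F w i) ^ 2 = 1)
    {X : ℝ → EuclideanSpace ℝ (Fin 3)} (hX : ContDiff ℝ 1 X) (hXu : ∀ τ, ‖deriv X τ‖ = 1)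
    {Rb : ℝ} (hRb0 : 0 ≤ Rb) (hRb : Rb ≤ 1 / 2) (hosc : ∀ τ σ, ‖deriv X τ - deriv X σ‖ ≤ Rb)
    (hFX : ∀ r : ℝ, (r : ℂ) ∈ {z : ℂ | |z.im| < hs ∧ |z.re - cc| < L + hs} →
      F r = fun i => ((⟪X r, EuclideanSpace.single i (1:ℝ)⟫_ℝ : ℝ) : ℂ))
    {A : ℝ → ℝ} (hA : ∀ σ, 0 ≤ A σ) (hκ : 0 ≤ κ)
    (hhs : 0 < hs) {z : ℂ} (hzim : |z.im| < hs / 4) (hzre : |z.re - cc| < L + hs / 4) {σ : ℝ} (hσ : hs / 2 ≤ σ - z.re) :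
    (σ - z.re) ^ 2 / 4 ≤ ((∑ i, (F z i - ((X σ i : ℝ) : ℂ)) ^ 2) + ((κ * A σ : ℝ) : ℂ)).re ∧
    ‖(((∑ i, (F z i - ((X σ i : ℝ) : ℂ)) ^ 2) + ((κ * A σ : ℝ) : ℂ)) ^ ((3:ℂ) / 2))⁻¹ •
        ((fun i => ((deriv X σ i : ℝ) : ℂ)) ⨯₃ (fun i => F z i - ((X σ i : ℝ) : ℂ)))‖ ≤
      160 * ((1:ℝ) ^ 2 * (σ - z.re) ^ 2 + (hs / 2) ^ 2)⁻¹ := by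
  set S : Set ℂ := {z : ℂ | |z.im| < hs ∧ |z.re - cc| < L + hs} with hS
  set D : ℝ := σ - z.re with hD
  have hD0 : 0 < D := by linarith
  have hre := quarter_foot_re_ge hF hM hunit hX hXu hRb0 hRb hosc hFX hhs hzim hzre hσ
  have hκA : 0 ≤ κ * A σ := mul_nonneg hκ (hA σ)
  have hmargin : D ^ 2 / 4 ≤ ((∑ i, (F z i - ((X σ i : ℝ) : ℂ)) ^ 2) + ((κ * A σ : ℝ) : ℂ)).re := by
    rw [Complex.add_re, Complex.ofReal_re]; linarith
  refine ⟨hmargin, ?_⟩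
  have hLs : 0 < L + hs := by have : 0 ≤ |z.re - cc| := abs_nonneg _; linarith
  have hzS : z ∈ S := ⟨by linarith, by linarith⟩
  have hxS : ((z.re : ℝ) : ℂ) ∈ S := ⟨by simpa using hhs, by simpa using (by linarith : |z.re - cc| < L + hs)⟩
  have hFx : F (z.re : ℝ) = fun i => ((X z.re i : ℝ) : ℂ) := by
    rw [hFX z.re hxS]; funext i; rw [inner_single_eq]
  have hchord : ‖(fun i => F z i - ((X σ i : ℝ) : ℂ))‖ ≤ 2 * D := by
    have e : (fun i => F z i - ((X σ i : ℝ) : ℂ)) =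
        (F z - F (z.re : ℝ)) + (fun i => ((⟪X z.re - X σ, EuclideanSpace.single i (1:ℝ)⟫_ℝ : ℝ) : ℂ)) := by
      funext i
      simp only [Pi.add_apply, Pi.sub_apply, hFx, inner_single_eq, PiLp.sub_apply, Complex.ofReal_sub]
      ring
    rw [e]
    have h1 : ‖F z - F (z.re : ℝ)‖ ≤ 2 * ‖z - (z.re : ℂ)‖ := (component_lipschitz hF hM hzS hxS).1
    have h1' : ‖z - (z.re : ℂ)‖ = |z.im| := by
      have : z - (z.re : ℂ) = (z.im : ℂ) * Complex.I := Complex.ext (by simp) (by simp)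
      rw [this, norm_mul, Complex.norm_real, Complex.norm_I, mul_one, Real.norm_eq_abs]
    have h2 : ‖(fun i => ((⟪X z.re - X σ, EuclideanSpace.single i (1:ℝ)⟫_ℝ : ℝ) : ℂ))‖ ≤ |z.re - σ| :=
      (norm_cplx_le _).trans (norm_sub_le_of_unit_speed hX.differentiable_one hXu _ _)
    have h2' : |z.re - σ| = D := by rw [abs_sub_comm]; exact abs_of_pos hD0
    calc ‖(F z - F (z.re : ℝ)) + (fun i => ((⟪X z.re - X σ, EuclideanSpace.single i (1:ℝ)⟫_ℝ : ℝ) : ℂ))‖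
        ≤ ‖F z - F (z.re : ℝ)‖ + ‖(fun i => ((⟪X z.re - X σ, EuclideanSpace.single i (1:ℝ)⟫_ℝ : ℝ) : ℂ))‖ := norm_add_le _ _
      _ ≤ 2 * |z.im| + D := by rw [← h1', ← h2']; exact add_le_add h1 h2
      _ ≤ 2 * D := by
          have : |z.im| < hs / 4 := hzim
          linarith
  have hD1 : ‖(fun i => ((deriv X σ i : ℝ) : ℂ))‖ ≤ 1 := by
    refine (pi_norm_le_iff_of_nonneg zero_le_one).2 fun i => ?_
    rw [Complex.norm_real]
    exact (PiLp.norm_apply_le (deriv X σ) i).trans (hXu σ).le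
  have hμ : 0 < D ^ 2 / 4 := by positivity
  have hker := segment_kernel_norm_le hμ hmargin hD1 hchord
  refine hker.trans ?_
  have hD2 : 0 < D / 2 := by positivity
  have hpow : (D ^ 2 / 4) ^ (-(3/2 : ℝ)) = ((D / 2) ^ 3)⁻¹ := by
    have hb : D ^ 2 / 4 = (D / 2) ^ (2:ℝ) := by rw [Real.rpow_two]; ring
    rw [hb, ← Real.rpow_mul hD2.le, show (2:ℝ) * -(3/2 : ℝ) = -(3:ℝ) by norm_num, Real.rpow_neg hD2.le,
      show (3:ℝ) = ((3:ℕ) : ℝ) by norm_num, Real.rpow_natCast]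
  rw [hpow]
  have e32 : ((D / 2) ^ 3)⁻¹ * (2 * 1 * (2 * D)) = 32 / D ^ 2 := by
    field_simp
    ring
  rw [e32]
  have hfar := far_majorant_le (a := hs / 2) (k := 1) (C := 32) (σ₀ := z.re) (σ := σ) (d := D) (by positivity) zero_le_one
    (by norm_num) (by linarith) (by rw [← hD, abs_of_pos hD0]; linarith)
  rw [show σ - z.re = D from rfl] at hfar
  linarith [hfar]

/-- **Kernel bound on the target's own left foot** (`hs/2 ≤ Re z − σ`). [folklore] -/
theorem own_foot_kernel_le_left {hs L cc κ : ℝ} {F : ℂ → (Fin 3 → ℂ)}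
    (hF : DifferentiableOn ℂ F {z : ℂ | |z.im| < hs ∧ |z.re - cc| < L + hs})
    (hM : ∀ z ∈ {z : ℂ | |z.im| < hs ∧ |z.re - cc| < L + hs}, ‖deriv F z‖ ≤ 2)
    (hunit : ∀ w ∈ {z : ℂ | |z.im| < hs ∧ |z.re - cc| < L + hs}, ∑ i, (deriv F w i) ^ 2 = 1)
    {X : ℝ → EuclideanSpace ℝ (Fin 3)} (hX : ContDiff ℝ 1 X) (hXu : ∀ τ, ‖deriv X τ‖ = 1)
    {Rb : ℝ} (hRb0 : 0 ≤ Rb) (hRb : Rb ≤ 1 / 2) (hosc : ∀ τ σ, ‖deriv X τ - deriv X σ‖ ≤ Rb)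
    (hFX : ∀ r : ℝ, (r : ℂ) ∈ {z : ℂ | |z.im| < hs ∧ |z.re - cc| < L + hs} →
      F r = fun i => ((⟪X r, EuclideanSpace.single i (1:ℝ)⟫_ℝ : ℝ) : ℂ))
    {A : ℝ → ℝ} (hA : ∀ σ, 0 ≤ A σ) (hκ : 0 ≤ κ)
    (hhs : 0 < hs) {z : ℂ} (hzim : |z.im| < hs / 4) (hzre : |z.re - cc| < L + hs / 4) {σ : ℝ} (hσ : hs / 2 ≤ z.re - σ) :
    (z.re - σ) ^ 2 / 4 ≤ ((∑ i, (F z i - ((X σ i : ℝ) : ℂ)) ^ 2) + ((κ * A σ : ℝ) : ℂ)).re ∧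
    ‖(((∑ i, (F z i - ((X σ i : ℝ) : ℂ)) ^ 2) + ((κ * A σ : ℝ) : ℂ)) ^ ((3:ℂ) / 2))⁻¹ •
        ((fun i => ((deriv X σ i : ℝ) : ℂ)) ⨯₃ (fun i => F z i - ((X σ i : ℝ) : ℂ)))‖ ≤
      160 * ((1:ℝ) ^ 2 * (σ - z.re) ^ 2 + (hs / 2) ^ 2)⁻¹ := by
  set S : Set ℂ := {z : ℂ | |z.im| < hs ∧ |z.re - cc| < L + hs} with hS
  set D : ℝ := z.re - σ with hD
  have hD0 : 0 < D := by linarith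
  have hre := quarter_foot_re_ge_left hF hM hunit hX hXu hRb0 hRb hosc hFX hhs hzim hzre hσ
  have hκA : 0 ≤ κ * A σ := mul_nonneg hκ (hA σ)
  have hmargin : D ^ 2 / 4 ≤ ((∑ i, (F z i - ((X σ i : ℝ) : ℂ)) ^ 2) + ((κ * A σ : ℝ) : ℂ)).re := by
    rw [Complex.add_re, Complex.ofReal_re]; linarith
  refine ⟨hmargin, ?_⟩
  have hLs : 0 < L + hs := by have : 0 ≤ |z.re - cc| := abs_nonneg _; linarith
  have hzS : z ∈ S := ⟨by linarith, by linarith⟩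
  have hxS : ((z.re : ℝ) : ℂ) ∈ S := ⟨by simpa using hhs, by simpa using (by linarith : |z.re - cc| < L + hs)⟩
  have hFx : F (z.re : ℝ) = fun i => ((X z.re i : ℝ) : ℂ) := by
    rw [hFX z.re hxS]; funext i; rw [inner_single_eq]
  have hchord : ‖(fun i => F z i - ((X σ i : ℝ) : ℂ))‖ ≤ 2 * D := by
    have e : (fun i => F z i - ((X σ i : ℝ) : ℂ)) =
        (F z - F (z.re : ℝ)) + (fun i => ((⟪X z.re - X σ, EuclideanSpace.single i (1:ℝ)⟫_ℝ : ℝ) : ℂ)) := by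
      funext i
      simp only [Pi.add_apply, Pi.sub_apply, hFx, inner_single_eq, PiLp.sub_apply, Complex.ofReal_sub]
      ring
    rw [e]
    have h1 : ‖F z - F (z.re : ℝ)‖ ≤ 2 * ‖z - (z.re : ℂ)‖ := (component_lipschitz hF hM hzS hxS).1
    have h1' : ‖z - (z.re : ℂ)‖ = |z.im| := by
      have : z - (z.re : ℂ) = (z.im : ℂ) * Complex.I := Complex.ext (by simp) (by simp)
      rw [this, norm_mul, Complex.norm_real, Complex.norm_I, mul_one, Real.norm_eq_abs]
    have h2 : ‖(fun i => ((⟪X z.re - X σ, EuclideanSpace.single i (1:ℝ)⟫_ℝ : ℝ) : ℂ))‖ ≤ |z.re - σ| :=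
      (norm_cplx_le _).trans (norm_sub_le_of_unit_speed hX.differentiable_one hXu _ _)
    have h2' : |z.re - σ| = D := abs_of_pos hD0
    calc ‖(F z - F (z.re : ℝ)) + (fun i => ((⟪X z.re - X σ, EuclideanSpace.single i (1:ℝ)⟫_ℝ : ℝ) : ℂ))‖
        ≤ ‖F z - F (z.re : ℝ)‖ + ‖(fun i => ((⟪X z.re - X σ, EuclideanSpace.single i (1:ℝ)⟫_ℝ : ℝ) : ℂ))‖ := norm_add_le _ _
      _ ≤ 2 * |z.im| + D := by rw [← h1', ← h2']; exact add_le_add h1 h2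
      _ ≤ 2 * D := by
          have : |z.im| < hs / 4 := hzim
          linarith
  have hD1 : ‖(fun i => ((deriv X σ i : ℝ) : ℂ))‖ ≤ 1 := by
    refine (pi_norm_le_iff_of_nonneg zero_le_one).2 fun i => ?_
    rw [Complex.norm_real]
    exact (PiLp.norm_apply_le (deriv X σ) i).trans (hXu σ).le
  have hμ : 0 < D ^ 2 / 4 := by positivity
  have hker := segment_kernel_norm_le hμ hmargin hD1 hchord
  refine hker.trans ?_
  have hD2 : 0 < D / 2 := by positivity
  have hpow : (D ^ 2 / 4) ^ (-(3/2 : ℝ)) = ((D / 2) ^ 3)⁻¹ := by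
    have hb : D ^ 2 / 4 = (D / 2) ^ (2:ℝ) := by rw [Real.rpow_two]; ring
    rw [hb, ← Real.rpow_mul hD2.le, show (2:ℝ) * -(3/2 : ℝ) = -(3:ℝ) by norm_num, Real.rpow_neg hD2.le,
      show (3:ℝ) = ((3:ℕ) : ℝ) by norm_num, Real.rpow_natCast]
  rw [hpow]
  have e32 : ((D / 2) ^ 3)⁻¹ * (2 * 1 * (2 * D)) = 32 / D ^ 2 := by
    field_simp
    ring
  rw [e32]
  have hfar := far_majorant_le (a := hs / 2) (k := 1) (C := 32) (σ₀ := z.re) (σ := σ) (d := D) (by positivity) zero_le_one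
    (by norm_num) (by linarith) (by rw [abs_of_neg (by linarith : σ - z.re < 0)]; linarith)
  have e : (σ - z.re) ^ 2 = D ^ 2 := by rw [hD]; ring
  rw [e] at hfar ⊢
  linarith [hfar]

/-- **The target's own right foot is integrable and `O(1/hs)`.** [folklore] -/
theorem own_foot_right {hs L cc κ : ℝ} {F : ℂ → (Fin 3 → ℂ)}
    (hF : DifferentiableOn ℂ F {z : ℂ | |z.im| < hs ∧ |z.re - cc| < L + hs})
    (hM : ∀ z ∈ {z : ℂ | |z.im| < hs ∧ |z.re - cc| < L + hs}, ‖deriv F z‖ ≤ 2)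
    (hunit : ∀ w ∈ {z : ℂ | |z.im| < hs ∧ |z.re - cc| < L + hs}, ∑ i, (deriv F w i) ^ 2 = 1)
    {X : ℝ → EuclideanSpace ℝ (Fin 3)} (hX : ContDiff ℝ 1 X) (hXu : ∀ τ, ‖deriv X τ‖ = 1)
    {Rb : ℝ} (hRb0 : 0 ≤ Rb) (hRb : Rb ≤ 1 / 2) (hosc : ∀ τ σ, ‖deriv X τ - deriv X σ‖ ≤ Rb)
    (hFX : ∀ r : ℝ, (r : ℂ) ∈ {z : ℂ | |z.im| < hs ∧ |z.re - cc| < L + hs} →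
      F r = fun i => ((⟪X r, EuclideanSpace.single i (1:ℝ)⟫_ℝ : ℝ) : ℂ))
    {A : ℝ → ℝ} (hAc : Continuous A) (hA : ∀ σ, 0 ≤ A σ) (hκ : 0 ≤ κ)
    (hhs : 0 < hs) {z : ℂ} (hzim : |z.im| < hs / 4) (hzre : |z.re - cc| < L + hs / 4) :
    IntegrableOn (fun σ => (((∑ i, (F z i - ((X σ i : ℝ) : ℂ)) ^ 2) + ((κ * A σ : ℝ) : ℂ)) ^ ((3:ℂ) / 2))⁻¹ •
        ((fun i => ((deriv X σ i : ℝ) : ℂ)) ⨯₃ (fun i => F z i - ((X σ i : ℝ) : ℂ)))) (Ici (z.re + hs / 2)) ∧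
    ‖∫ σ in Ici (z.re + hs / 2), (((∑ i, (F z i - ((X σ i : ℝ) : ℂ)) ^ 2) + ((κ * A σ : ℝ) : ℂ)) ^ ((3:ℂ) / 2))⁻¹ •
        ((fun i => ((deriv X σ i : ℝ) : ℂ)) ⨯₃ (fun i => F z i - ((X σ i : ℝ) : ℂ)))‖ ≤ 160 * (Real.pi / (1 * (hs / 2))) := by
  have hT : MeasurableSet (Ici (z.re + hs / 2)) := measurableSet_Ici
  have hpt : ∀ σ ∈ Ici (z.re + hs / 2), (σ - z.re) ^ 2 / 4 ≤ ((∑ i, (F z i - ((X σ i : ℝ) : ℂ)) ^ 2) + ((κ * A σ : ℝ) : ℂ)).re ∧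
      ‖(((∑ i, (F z i - ((X σ i : ℝ) : ℂ)) ^ 2) + ((κ * A σ : ℝ) : ℂ)) ^ ((3:ℂ) / 2))⁻¹ •
          ((fun i => ((deriv X σ i : ℝ) : ℂ)) ⨯₃ (fun i => F z i - ((X σ i : ℝ) : ℂ)))‖ ≤
        160 * ((1:ℝ) ^ 2 * (σ - z.re) ^ 2 + (hs / 2) ^ 2)⁻¹ := fun σ hσ =>
    own_foot_kernel_le hF hM hunit hX hXu hRb0 hRb hosc hFX hA hκ hhs hzim hzre (by have h : z.re + hs / 2 ≤ σ := hσ; linarith)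
  have hpos : ∀ σ ∈ Ici (z.re + hs / 2), 0 < ((∑ i, (F z i - ((X σ i : ℝ) : ℂ)) ^ 2) + ((κ * A σ : ℝ) : ℂ)).re := by
    intro σ hσ
    have h := (hpt σ hσ).1
    have hσ' : z.re + hs / 2 ≤ σ := hσ
    have hp : 0 < σ - z.re := by linarith
    have : 0 < (σ - z.re) ^ 2 / 4 := by positivity
    linarith
  have ha : 0 < hs / 2 := by positivity
  have hint : Integrable (fun σ : ℝ => 160 * ((1:ℝ) ^ 2 * (σ - z.re) ^ 2 + (hs / 2) ^ 2)⁻¹) :=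
    (integrable_lorentzian ha one_ne_zero z.re).const_mul _
  refine ⟨realKernel_integrableOn_of_bound hX hAc z hT hpos hint.integrableOn (fun σ hσ => (hpt σ hσ).2), ?_⟩
  have h1 := norm_integral_le_of_norm_le (μ := volume.restrict (Ici (z.re + hs / 2))) hint.integrableOn
    (by filter_upwards [ae_restrict_mem hT] with σ hσ; exact (hpt σ hσ).2)
  have h2 : ∫ σ in Ici (z.re + hs / 2), 160 * ((1:ℝ) ^ 2 * (σ - z.re) ^ 2 + (hs / 2) ^ 2)⁻¹ ≤
      ∫ σ, 160 * ((1:ℝ) ^ 2 * (σ - z.re) ^ 2 + (hs / 2) ^ 2)⁻¹ :=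
    setIntegral_le_integral hint (Filter.Eventually.of_forall fun σ => by positivity)
  refine h1.trans (h2.trans ?_)
  rw [integral_const_mul, integral_lorentzian ha one_ne_zero z.re, abs_one]

/-- **The target's own left foot is integrable and `O(1/hs)`.** [folklore] -/
theorem own_foot_left {hs L cc κ : ℝ} {F : ℂ → (Fin 3 → ℂ)}
    (hF : DifferentiableOn ℂ F {z : ℂ | |z.im| < hs ∧ |z.re - cc| < L + hs})
    (hM : ∀ z ∈ {z : ℂ | |z.im| < hs ∧ |z.re - cc| < L + hs}, ‖deriv F z‖ ≤ 2)
    (hunit : ∀ w ∈ {z : ℂ | |z.im| < hs ∧ |z.re - cc| < L + hs}, ∑ i, (deriv F w i) ^ 2 = 1)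
    {X : ℝ → EuclideanSpace ℝ (Fin 3)} (hX : ContDiff ℝ 1 X) (hXu : ∀ τ, ‖deriv X τ‖ = 1)
    {Rb : ℝ} (hRb0 : 0 ≤ Rb) (hRb : Rb ≤ 1 / 2) (hosc : ∀ τ σ, ‖deriv X τ - deriv X σ‖ ≤ Rb)
    (hFX : ∀ r : ℝ, (r : ℂ) ∈ {z : ℂ | |z.im| < hs ∧ |z.re - cc| < L + hs} →
      F r = fun i => ((⟪X r, EuclideanSpace.single i (1:ℝ)⟫_ℝ : ℝ) : ℂ))
    {A : ℝ → ℝ} (hAc : Continuous A) (hA : ∀ σ, 0 ≤ A σ) (hκ : 0 ≤ κ)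
    (hhs : 0 < hs) {z : ℂ} (hzim : |z.im| < hs / 4) (hzre : |z.re - cc| < L + hs / 4) :
    IntegrableOn (fun σ => (((∑ i, (F z i - ((X σ i : ℝ) : ℂ)) ^ 2) + ((κ * A σ : ℝ) : ℂ)) ^ ((3:ℂ) / 2))⁻¹ •
        ((fun i => ((deriv X σ i : ℝ) : ℂ)) ⨯₃ (fun i => F z i - ((X σ i : ℝ) : ℂ)))) (Iic (z.re - hs / 2)) ∧
    ‖∫ σ in Iic (z.re - hs / 2), (((∑ i, (F z i - ((X σ i : ℝ) : ℂ)) ^ 2) + ((κ * A σ : ℝ) : ℂ)) ^ ((3:ℂ) / 2))⁻¹ •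
        ((fun i => ((deriv X σ i : ℝ) : ℂ)) ⨯₃ (fun i => F z i - ((X σ i : ℝ) : ℂ)))‖ ≤ 160 * (Real.pi / (1 * (hs / 2))) := by
  have hT : MeasurableSet (Iic (z.re - hs / 2)) := measurableSet_Iic
  have hpt : ∀ σ ∈ Iic (z.re - hs / 2), (z.re - σ) ^ 2 / 4 ≤ ((∑ i, (F z i - ((X σ i : ℝ) : ℂ)) ^ 2) + ((κ * A σ : ℝ) : ℂ)).re ∧
      ‖(((∑ i, (F z i - ((X σ i : ℝ) : ℂ)) ^ 2) + ((κ * A σ : ℝ) : ℂ)) ^ ((3:ℂ) / 2))⁻¹ •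
          ((fun i => ((deriv X σ i : ℝ) : ℂ)) ⨯₃ (fun i => F z i - ((X σ i : ℝ) : ℂ)))‖ ≤
        160 * ((1:ℝ) ^ 2 * (σ - z.re) ^ 2 + (hs / 2) ^ 2)⁻¹ := fun σ hσ =>
    own_foot_kernel_le_left hF hM hunit hX hXu hRb0 hRb hosc hFX hA hκ hhs hzim hzre (by have h : σ ≤ z.re - hs / 2 := hσ; linarith)
  have hpos : ∀ σ ∈ Iic (z.re - hs / 2), 0 < ((∑ i, (F z i - ((X σ i : ℝ) : ℂ)) ^ 2) + ((κ * A σ : ℝ) : ℂ)).re := by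
    intro σ hσ
    have h := (hpt σ hσ).1
    have hσ' : σ ≤ z.re - hs / 2 := hσ
    have hp : 0 < z.re - σ := by linarith
    have : 0 < (z.re - σ) ^ 2 / 4 := by positivity
    linarith
  have ha : 0 < hs / 2 := by positivity
  have hint : Integrable (fun σ : ℝ => 160 * ((1:ℝ) ^ 2 * (σ - z.re) ^ 2 + (hs / 2) ^ 2)⁻¹) :=
    (integrable_lorentzian ha one_ne_zero z.re).const_mul _
  refine ⟨realKernel_integrableOn_of_bound hX hAc z hT hpos hint.integrableOn (fun σ hσ => (hpt σ hσ).2), ?_⟩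
  have h1 := norm_integral_le_of_norm_le (μ := volume.restrict (Iic (z.re - hs / 2))) hint.integrableOn
    (by filter_upwards [ae_restrict_mem hT] with σ hσ; exact (hpt σ hσ).2)
  have h2 : ∫ σ in Iic (z.re - hs / 2), 160 * ((1:ℝ) ^ 2 * (σ - z.re) ^ 2 + (hs / 2) ^ 2)⁻¹ ≤
      ∫ σ, 160 * ((1:ℝ) ^ 2 * (σ - z.re) ^ 2 + (hs / 2) ^ 2)⁻¹ :=
    setIntegral_le_integral hint (Filter.Eventually.of_forall fun σ => by positivity)
  refine h1.trans (h2.trans ?_)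
  rw [integral_const_mul, integral_lorentzian ha one_ne_zero z.re, abs_one]

end Summit.NavierStokesRegularity.NavierStokesRegularity.Theorems.StadiumQuarterOwnFeet

end
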